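import Summits.Ventures.PercRepro.SeriesParallelC005

/-!
# C-005 for every subdivision of a marked multigraph with at most eight edges

The **subdivision** `H.subdivision ℓ` of a multigraph `H` replaces every edge `e` of `H` by a path
of `ℓ e + 1` edges through `ℓ e` new internal vertices (`subdivVtx`); the marks stay at the vertices
of `H`. Reducing every path from its far end by series steps at its (unmarked, degree-two) internal
vertices (`SeriesParallelC005.lean`) leaves one live edge per edge of `H`, so when `H` has at most
eight edges `C005At_of_reduces` gives the C-005 inequality for the subdivision at every weight.

The reduction is tracked explicitly: after `m e` steps on the path of `e` the graph is
`subdivStage H ℓ m` (the edges `i < ℓ e - m e` unchanged, the edge `ℓ e - m e` re-attached to the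
far endpoint of `e`, the later edges dead) and the weight is `subdivWeight ℓ p m` (the re-attached
edge carries the product of the weights it absorbed). The step lemmas `isSeries_subdivStage`,
`seriesGraph_subdivStage`, `serWeight_subdivWeight` give one `SPStep` (`spStep_subdivStage`), an
induction on `∑ e, m e` gives the chain (`reduces_subdivStage`), and the final weight has at most
`card E₀` live edges (`card_liveEdges_subdivWeight_le`).

**`C005At_subdivision`**: C-005 at every `p` for every subdivision of every marked multigraph with
at most eight edges; **`C005At_subdivisionK4`**: every subdivided `K₄` — six terminal paths of
arbitrary lengths — the infinite family of `SeriesParallelC005.lean`, now named in the kernel.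
-/

namespace PercRepro

namespace MultiGraph

open Finset

variable {V₀ E₀ : Type}

/-- The `i`-th vertex of the path replacing the edge `e` in the subdivision: the first endpoint of
`e` at `i = 0`, its second endpoint at `i = ℓ e + 1` (and beyond), the new internal vertex `(e, i)`
in between. -/
def subdivVtx (H : MultiGraph V₀ E₀) (ℓ : E₀ → ℕ) (e : E₀) (i : ℕ) : V₀ ⊕ (E₀ × ℕ) :=
  if i = 0 then Sum.inl (H.fst e) else if ℓ e < i then Sum.inl (H.snd e) else Sum.inr (e, i)

/-- The edges of the subdivision: the `i`-th edge of the path replacing `e`, `0 ≤ i ≤ ℓ e`. -/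
abbrev SubdivEdge (ℓ : E₀ → ℕ) : Type := Σ e : E₀, Fin (ℓ e + 1)

/-- **The subdivision** of `H` with `ℓ e` new vertices on the edge `e`: the edge `(e, i)` joins the
`i`-th and the `(i + 1)`-st vertices of the path of `e`. -/
def subdivision (H : MultiGraph V₀ E₀) (ℓ : E₀ → ℕ) :
    MultiGraph (V₀ ⊕ (E₀ × ℕ)) (SubdivEdge ℓ) where
  fst x := subdivVtx H ℓ x.1 x.2
  snd x := subdivVtx H ℓ x.1 ((x.2 : ℕ) + 1)

/-- The graph after `m e` series steps on the path of each `e`, taken from its far end: the edges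
`i < ℓ e - m e` are unchanged, the edge `ℓ e - m e` is re-attached to the far endpoint of `e`, and
the later (dead) edges end there as well. -/
def subdivStage (H : MultiGraph V₀ E₀) (ℓ m : E₀ → ℕ) :
    MultiGraph (V₀ ⊕ (E₀ × ℕ)) (SubdivEdge ℓ) where
  fst x := subdivVtx H ℓ x.1 x.2
  snd x := if (x.2 : ℕ) < ℓ x.1 - m x.1 then subdivVtx H ℓ x.1 ((x.2 : ℕ) + 1)
    else Sum.inl (H.snd x.1)

/-- The weight of the `j`-th edge of the path of `e` as a function of `j : ℕ` (`1` beyond it). -/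
noncomputable def pathWeight (ℓ : E₀ → ℕ) (p : SubdivEdge ℓ → ℝ) (e : E₀) (j : ℕ) : ℝ :=
  if h : j < ℓ e + 1 then p ⟨e, ⟨j, h⟩⟩ else 1

/-- The weight after `m e` series steps on the path of each `e`: the edges `i < ℓ e - m e` keep
their weight, the edge `ℓ e - m e` carries the product of the weights of the edges
`ℓ e - m e, …, ℓ e`, and the later edges are dead. -/
noncomputable def subdivWeight (ℓ : E₀ → ℕ) (p : SubdivEdge ℓ → ℝ) (m : E₀ → ℕ) :
    SubdivEdge ℓ → ℝ :=
  fun x => if (x.2 : ℕ) < ℓ x.1 - m x.1 then p x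
    else if (x.2 : ℕ) = ℓ x.1 - m x.1 then ∏ j ∈ Ico (x.2 : ℕ) (ℓ x.1 + 1), pathWeight ℓ p x.1 j
    else 0

section Vertices

variable {H : MultiGraph V₀ E₀} {ℓ : E₀ → ℕ}

/-- The path of `e` ends at the second endpoint of `e`. -/
theorem subdivVtx_last (e : E₀) : subdivVtx H ℓ e (ℓ e + 1) = Sum.inl (H.snd e) := by
  simp [subdivVtx]

/-- The internal vertices of the path of `e`. -/
theorem subdivVtx_of_lt {e : E₀} {i : ℕ} (h0 : 0 < i) (h1 : i ≤ ℓ e) :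
    subdivVtx H ℓ e i = Sum.inr (e, i) := by
  unfold subdivVtx
  rw [if_neg (by omega), if_neg (by omega)]

/-- When a path vertex is a given internal vertex. -/
theorem subdivVtx_eq_inr_iff {e e' : E₀} {i j : ℕ} :
    subdivVtx H ℓ e i = Sum.inr (e', j) ↔ 0 < i ∧ i ≤ ℓ e ∧ e = e' ∧ i = j := by
  unfold subdivVtx
  split_ifs with h0 h1
  · subst h0
    simp
  · exact ⟨fun h => by simp at h, fun ⟨_, h, _, _⟩ => by omega⟩
  · simp only [Sum.inr.injEq, Prod.mk.injEq]
    exact ⟨fun h => ⟨by omega, by omega, h.1, h.2⟩, fun h => ⟨h.2.2.1, h.2.2.2⟩⟩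

/-- Equality of two edges on the same path. -/
theorem subdivEdge_mk_eq_iff {e : E₀} {i i' : Fin (ℓ e + 1)} :
    (⟨e, i⟩ : SubdivEdge ℓ) = ⟨e, i'⟩ ↔ (i : ℕ) = i' := by
  rw [Sigma.mk.inj_iff]
  simp [Fin.ext_iff]

/-- Edges on the same path with different indices are different. -/
theorem subdivEdge_mk_ne_of_ne {e : E₀} {i i' : Fin (ℓ e + 1)} (h : (i : ℕ) ≠ i') :
    (⟨e, i⟩ : SubdivEdge ℓ) ≠ ⟨e, i'⟩ :=
  fun h' => h (subdivEdge_mk_eq_iff.1 h')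

/-- Edges on different paths are different. -/
theorem subdivEdge_mk_ne {e e' : E₀} (h : e ≠ e') {i : Fin (ℓ e + 1)} {i' : Fin (ℓ e' + 1)} :
    (⟨e, i⟩ : SubdivEdge ℓ) ≠ ⟨e', i'⟩ :=
  fun h' => h (Sigma.mk.inj_iff.1 h').1

end Vertices

section Stage

variable {H : MultiGraph V₀ E₀} {ℓ : E₀ → ℕ}

/-- Before any step the stage graph is the subdivision. -/
theorem subdivStage_zero : subdivStage H ℓ 0 = subdivision H ℓ := by
  unfold subdivStage subdivision
  congr 1
  funext x
  simp only [Pi.zero_apply, Nat.sub_zero]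
  split_ifs with h
  · rfl
  · have hx : (x.2 : ℕ) = ℓ x.1 := by have := x.2.isLt; omega
    rw [hx, subdivVtx_last]

/-- Before any step the stage weight is `p`. -/
theorem subdivWeight_zero (p : SubdivEdge ℓ → ℝ) : subdivWeight ℓ p 0 = p := by
  funext x
  obtain ⟨e, i⟩ := x
  simp only [subdivWeight, Pi.zero_apply, Nat.sub_zero]
  split_ifs with h1 h2
  · rfl
  · have hi : (⟨e, i⟩ : SubdivEdge ℓ) = ⟨e, ⟨ℓ e, Nat.lt_succ_self _⟩⟩ :=
      subdivEdge_mk_eq_iff.2 h2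
    rw [hi, h2, Nat.Ico_succ_singleton, prod_singleton, pathWeight,
      dif_pos (Nat.lt_succ_self _)]
  · exact absurd i.isLt (by omega)

/-- The path weight on the path. -/
theorem pathWeight_of_lt (p : SubdivEdge ℓ → ℝ) {e : E₀} {j : ℕ} (h : j < ℓ e + 1) :
    pathWeight ℓ p e j = p ⟨e, ⟨j, h⟩⟩ :=
  dif_pos h

/-- The value of the stage weight below the re-attached edge. -/
theorem subdivWeight_of_lt (p : SubdivEdge ℓ → ℝ) (m : E₀ → ℕ) {e : E₀} {i : Fin (ℓ e + 1)}
    (h : (i : ℕ) < ℓ e - m e) : subdivWeight ℓ p m ⟨e, i⟩ = p ⟨e, i⟩ := by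
  simp only [subdivWeight]
  rw [if_pos h]

/-- The value of the stage weight on the re-attached edge. -/
theorem subdivWeight_of_eq (p : SubdivEdge ℓ → ℝ) (m : E₀ → ℕ) {e : E₀} {i : Fin (ℓ e + 1)}
    (h : (i : ℕ) = ℓ e - m e) :
    subdivWeight ℓ p m ⟨e, i⟩ = ∏ j ∈ Ico (i : ℕ) (ℓ e + 1), pathWeight ℓ p e j := by
  simp only [subdivWeight]
  rw [if_neg (by omega), if_pos h]

/-- The value of the stage weight beyond the re-attached edge. -/
theorem subdivWeight_of_gt (p : SubdivEdge ℓ → ℝ) (m : E₀ → ℕ) {e : E₀} {i : Fin (ℓ e + 1)}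
    (h : ℓ e - m e < i) : subdivWeight ℓ p m ⟨e, i⟩ = 0 := by
  simp only [subdivWeight]
  rw [if_neg (by omega), if_neg (by omega)]

/-- The stage weight on the path of `e'` does not depend on `m e` for `e ≠ e'`. -/
theorem subdivWeight_update_of_ne [DecidableEq E₀] (p : SubdivEdge ℓ → ℝ) (m : E₀ → ℕ) {e e' : E₀}
    (h : e ≠ e') (n : ℕ) (i : Fin (ℓ e' + 1)) :
    subdivWeight ℓ p (Function.update m e n) ⟨e', i⟩ = subdivWeight ℓ p m ⟨e', i⟩ := by
  simp only [subdivWeight, Function.update_of_ne (Ne.symm h)]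

end Stage

section Step

variable {H : MultiGraph V₀ E₀} {ℓ : E₀ → ℕ}

/-- **The series step** at the last internal vertex still on the path of `e`: after `m e` steps the
vertex `(e, j + 1)` with `m e + (j + 1) = ℓ e` has exactly the edges `(e, j)` and `(e, j + 1)`. -/
theorem isSeries_subdivStage {m : E₀ → ℕ} {e : E₀} {j : ℕ} (hj : m e + (j + 1) = ℓ e) :
    (subdivStage H ℓ m).IsSeries ⟨e, ⟨j, by omega⟩⟩ ⟨e, ⟨j + 1, by omega⟩⟩ (Sum.inr (e, j + 1))
      (subdivVtx H ℓ e j) (Sum.inl (H.snd e)) := by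
  refine ⟨?_, ?_, ?_, ?_, ?_, ?_⟩
  · intro h
    have h' := subdivEdge_mk_eq_iff.1 h
    simp at h'
  · left
    refine ⟨rfl, ?_⟩
    show (if j < ℓ e - m e then subdivVtx H ℓ e (j + 1) else Sum.inl (H.snd e)) =
      Sum.inr (e, j + 1)
    rw [if_pos (by omega), subdivVtx_of_lt (by omega) (by omega)]
  · left
    refine ⟨?_, ?_⟩
    · show subdivVtx H ℓ e (j + 1) = Sum.inr (e, j + 1)
      exact subdivVtx_of_lt (by omega) (by omega)
    · show (if j + 1 < ℓ e - m e then subdivVtx H ℓ e (j + 1 + 1) else Sum.inl (H.snd e)) =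
        Sum.inl (H.snd e)
      rw [if_neg (by omega)]
  · intro h
    rw [subdivVtx_eq_inr_iff] at h
    obtain ⟨-, -, -, h⟩ := h
    omega
  · exact Sum.inl_ne_inr
  · rintro ⟨e', i'⟩ h
    rcases h with h | h
    · change subdivVtx H ℓ e' i' = Sum.inr (e, j + 1) at h
      rw [subdivVtx_eq_inr_iff] at h
      obtain ⟨-, -, rfl, hi⟩ := h
      right
      exact subdivEdge_mk_eq_iff.2 hi
    · change (if (i' : ℕ) < ℓ e' - m e' then subdivVtx H ℓ e' ((i' : ℕ) + 1)
          else Sum.inl (H.snd e')) = Sum.inr (e, j + 1) at h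
      split_ifs at h with hi
      rw [subdivVtx_eq_inr_iff] at h
      obtain ⟨-, -, rfl, hi'⟩ := h
      left
      exact subdivEdge_mk_eq_iff.2 (by show (i' : ℕ) = j; omega)

variable [DecidableEq E₀]

/-- **The graph after the step** is the next stage graph. -/
theorem seriesGraph_subdivStage {m : E₀ → ℕ} {e : E₀} {j : ℕ} (hj : m e + (j + 1) = ℓ e) :
    (subdivStage H ℓ m).seriesGraph ⟨e, ⟨j, by omega⟩⟩ (subdivVtx H ℓ e j) (Sum.inl (H.snd e)) =
      subdivStage H ℓ (Function.update m e (m e + 1)) := by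
  have hlt : ℓ e - m e = j + 1 := by omega
  have hlt' : ℓ e - (m e + 1) = j := by omega
  unfold seriesGraph subdivStage
  congr 1
  · funext x
    rw [Function.update_apply]
    split_ifs with hx
    · rw [hx]
    · rfl
  · funext x
    obtain ⟨e', i'⟩ := x
    by_cases he : e = e'
    · subst he
      simp only [Function.update_apply, subdivEdge_mk_eq_iff, hlt]
      split_ifs <;> first | rfl | (exfalso; omega)
    · simp only [Function.update_apply, if_neg (subdivEdge_mk_ne (Ne.symm he)), if_neg (Ne.symm he)]

/-- **The weight after the step** is the next stage weight. -/
theorem serWeight_subdivWeight (p : SubdivEdge ℓ → ℝ) {m : E₀ → ℕ} {e : E₀} {j : ℕ}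
    (hj : m e + (j + 1) = ℓ e) :
    serWeight (subdivWeight ℓ p m) ⟨e, ⟨j, by omega⟩⟩ ⟨e, ⟨j + 1, by omega⟩⟩ =
      subdivWeight ℓ p (Function.update m e (m e + 1)) := by
  have hlt : ℓ e - m e = j + 1 := by omega
  have hlt' : ℓ e - (m e + 1) = j := by omega
  funext x
  obtain ⟨e', i'⟩ := x
  by_cases he : e = e'
  · subst he
    unfold serWeight
    have hm1 : Function.update m e (m e + 1) e = m e + 1 := Function.update_self ..
    rcases Nat.lt_trichotomy (i' : ℕ) j with hi | hi | hi
    · -- below both edges of the step: nothing changes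
      rw [Function.update_of_ne (subdivEdge_mk_ne_of_ne (by show (i' : ℕ) ≠ j; omega)),
        Function.update_of_ne (subdivEdge_mk_ne_of_ne (by show (i' : ℕ) ≠ j + 1; omega)),
        subdivWeight_of_lt p m (by omega), subdivWeight_of_lt p _ (by rw [hm1]; omega)]
    · -- the re-attached edge: the product grows by one factor
      have hx : (⟨e, i'⟩ : SubdivEdge ℓ) = ⟨e, ⟨j, by omega⟩⟩ := subdivEdge_mk_eq_iff.2 hi
      rw [hx, Function.update_self, subdivWeight_of_lt p m (by show j < ℓ e - m e; omega),
        subdivWeight_of_eq p m (by show j + 1 = ℓ e - m e; omega),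
        subdivWeight_of_eq p _ (by rw [hm1]; show j = ℓ e - (m e + 1); omega),
        prod_eq_prod_Ico_succ_bot (show j < ℓ e + 1 by omega),
        pathWeight_of_lt p (show j < ℓ e + 1 by omega)]
    · rcases Nat.lt_or_ge (j + 1) (i' : ℕ) with hi' | hi'
      · -- beyond both edges of the step: dead before and after
        rw [Function.update_of_ne (subdivEdge_mk_ne_of_ne (by show (i' : ℕ) ≠ j; omega)),
          Function.update_of_ne (subdivEdge_mk_ne_of_ne (by show (i' : ℕ) ≠ j + 1; omega)),
          subdivWeight_of_gt p m (by omega), subdivWeight_of_gt p _ (by rw [hm1]; omega)]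
      · -- the deleted edge
        have hx : (⟨e, i'⟩ : SubdivEdge ℓ) = ⟨e, ⟨j + 1, by omega⟩⟩ :=
          subdivEdge_mk_eq_iff.2 (by show (i' : ℕ) = j + 1; omega)
        rw [hx, Function.update_of_ne (subdivEdge_mk_ne_of_ne (by show j + 1 ≠ j; omega)),
          Function.update_self,
          subdivWeight_of_gt p _ (by rw [hm1]; show ℓ e - (m e + 1) < j + 1; omega)]
  · unfold serWeight
    rw [Function.update_of_ne (subdivEdge_mk_ne (Ne.symm he)),
      Function.update_of_ne (subdivEdge_mk_ne (Ne.symm he)), subdivWeight_update_of_ne p m he]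

/-- **One reduction step** of the subdivision: the series step at the last internal vertex still on
the path of `e` (an unmarked vertex). -/
theorem spStep_subdivStage (p : SubdivEdge ℓ → ℝ) {m : E₀ → ℕ} {e : E₀} {j : ℕ}
    (hj : m e + (j + 1) = ℓ e) (a b c d : V₀) :
    SPStep (Sum.inl a) (Sum.inl b) (Sum.inl c) (Sum.inl d)
      (subdivStage H ℓ m, subdivWeight ℓ p m)
      (subdivStage H ℓ (Function.update m e (m e + 1)),
        subdivWeight ℓ p (Function.update m e (m e + 1))) := by
  have h := SPStep.series (a := Sum.inl a) (b := Sum.inl b) (c := Sum.inl c) (d := Sum.inl d)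
    (p := subdivWeight ℓ p m) (isSeries_subdivStage (H := H) hj) (by simp)
  rwa [seriesGraph_subdivStage hj, serWeight_subdivWeight p hj] at h

end Step

section Chain

variable [Fintype E₀] [DecidableEq E₀] {H : MultiGraph V₀ E₀} {ℓ : E₀ → ℕ}

/-- **The reduction chain**: the subdivision reduces to every stage `m ≤ ℓ` (induction on the number
of steps `∑ e, m e`). -/
theorem reduces_subdivStage (p : SubdivEdge ℓ → ℝ) (a b c d : V₀) (m : E₀ → ℕ)
    (hm : ∀ e, m e ≤ ℓ e) :
    Reduces (Sum.inl a) (Sum.inl b) (Sum.inl c) (Sum.inl d)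
      (subdivStage H ℓ 0, subdivWeight ℓ p 0) (subdivStage H ℓ m, subdivWeight ℓ p m) := by
  suffices h : ∀ n (m : E₀ → ℕ), ∑ e, m e = n → (∀ e, m e ≤ ℓ e) →
      Reduces (Sum.inl a) (Sum.inl b) (Sum.inl c) (Sum.inl d)
        (subdivStage H ℓ 0, subdivWeight ℓ p 0) (subdivStage H ℓ m, subdivWeight ℓ p m) from
    h _ m rfl hm
  intro n
  induction n with
  | zero =>
    intro m hsum _
    have hm0 : m = 0 := by
      funext e
      have h := single_le_sum (fun i _ => Nat.zero_le (m i)) (mem_univ e)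
      rw [hsum] at h
      exact Nat.le_zero.1 h
    subst hm0
    exact Relation.ReflTransGen.refl
  | succ n ih =>
    intro m hsum hm
    obtain ⟨e, he⟩ : ∃ e, m e ≠ 0 := by
      by_contra h
      simp only [ne_eq, not_exists, not_not] at h
      rw [sum_eq_zero (fun e _ => h e)] at hsum
      exact Nat.succ_ne_zero n hsum.symm
    set m' := Function.update m e (m e - 1) with hm'
    have hm'e : m' e = m e - 1 := Function.update_self ..
    have hsum' : ∑ x, m' x = n := by
      rw [hm', sum_update_of_mem (mem_univ e), sdiff_singleton_eq_erase]
      rw [← add_sum_erase univ m (mem_univ e)] at hsum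
      omega
    have hm'le : ∀ x, m' x ≤ ℓ x := by
      intro x
      rw [hm', Function.update_apply]
      split_ifs with hx
      · subst hx
        exact (Nat.sub_le _ _).trans (hm _)
      · exact hm x
    have hstep := spStep_subdivStage (H := H) p (m := m') (e := e) (j := ℓ e - m e)
      (by have := hm e; omega) a b c d
    have hmm : Function.update m' e (m' e + 1) = m := by
      funext x
      rw [Function.update_apply]
      split_ifs with hx
      · subst hx
        rw [hm'e]
        omega
      · rw [hm', Function.update_of_ne hx]
    rw [hmm] at hstep
    exact Relation.ReflTransGen.tail (ih m' hsum' hm'le) hstep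

/-- After the full reduction only the first edge of each path can be live. -/
theorem card_liveEdges_subdivWeight_le (p : SubdivEdge ℓ → ℝ) :
    (liveEdges (subdivWeight ℓ p ℓ)).card ≤ Fintype.card E₀ := by
  have hsub : liveEdges (subdivWeight ℓ p ℓ) ⊆
      univ.image fun e : E₀ => (⟨e, ⟨0, Nat.succ_pos _⟩⟩ : SubdivEdge ℓ) := by
    intro x hx
    rw [mem_liveEdges] at hx
    obtain ⟨e, i⟩ := x
    have hi : (i : ℕ) = 0 := by
      by_contra h
      exact hx (subdivWeight_of_gt p ℓ (by omega))
    exact mem_image.2 ⟨e, mem_univ _, subdivEdge_mk_eq_iff.2 hi.symm⟩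
  refine (card_le_card hsub).trans (card_image_le.trans ?_)
  rw [card_univ]

/-- **C-005 for every subdivision of a marked multigraph with at most eight edges**: for every
multigraph `H` with `card E₀ ≤ 8`, every family of path lengths `ℓ`, every weight vector `p` and
all marks `a, b, c, d` among the vertices of `H`, the C-005 inequality holds for `H.subdivision ℓ`
at `p`. -/
theorem C005At_subdivision (H : MultiGraph V₀ E₀) (ℓ : E₀ → ℕ) (hE : Fintype.card E₀ ≤ 8)
    (p : SubdivEdge ℓ → ℝ) (hp : IsProb p) (a b c d : V₀) :
    (H.subdivision ℓ).C005At p (Sum.inl a) (Sum.inl b) (Sum.inl c) (Sum.inl d) := by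
  have hp0 : IsProb (subdivWeight ℓ p 0) := by rwa [subdivWeight_zero]
  have h := C005At_of_reduces hp0 (reduces_subdivStage (H := H) p a b c d ℓ fun e => le_rfl)
    ((card_liveEdges_subdivWeight_le p).trans hE)
  rwa [subdivStage_zero, subdivWeight_zero] at h

end Chain

/-- The complete graph `K₄` on the terminals `0, 1, 2, 3` (edges `0–1, 0–2, 0–3, 1–2, 1–3, 2–3`; the
vectors of `Examples.k4` of `LemmaBPlusKernel.lean`, repeated to keep the import closure light). -/
def K4 : MultiGraph (Fin 4) (Fin 6) where
  fst := ![0, 0, 0, 1, 1, 2]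
  snd := ![1, 2, 3, 2, 3, 3]

/-- **C-005 for every subdivided `K₄` at every `p`**: six internally disjoint terminal paths of
arbitrary lengths `ℓ k + 1`, the marks at the four branch vertices. -/
theorem C005At_subdivisionK4 (ℓ : Fin 6 → ℕ) (p : SubdivEdge ℓ → ℝ) (hp : IsProb p) :
    (K4.subdivision ℓ).C005At p (Sum.inl 0) (Sum.inl 1) (Sum.inl 2) (Sum.inl 3) :=
  C005At_subdivision K4 ℓ (by simp) p hp 0 1 2 3

end MultiGraph

end PercRepro
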